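import Summits.HodgeConjecture.HodgeConjecture.Theorems.F0P3XiPacketFamilyOfRecordUnram   -- ★ `ramOfRecord₂`, `good_of_not_mem_ramOfRecord₂`
import Summits.HodgeConjecture.HodgeConjecture.Theorems.R90S7FormSignOffRam              -- ★ p861477 `R90.S7.formSignOffRam` (S7#6, R90-C146-p01 (g0), commit 31bf8d758f93) — ED. 3 (α) DISCHARGE
import Literature.NumberTheory.Automorphic.LocalHermitianFormSign                         -- ★ `formSignAt`, `formSignAt_of_not_subsingleton`, `formSignAt_eq_hilbertSymbol`
import Literature.NumberTheory.Automorphic.UnitaryGroupBorelInduction                     -- ★ `IsQuadraticCharExtension` (frame hypothesis `hquad`)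
import HarnessLib

/-!
# R90-TF · S7 (Ch. 14.6-tuple, C146) · FILE A `R90_S7_PKtupleBaseChainA` — EDITION 3 «(α) DISCHARGE» (ED. 2 e46362b65ce8723d 19cfdf42b32b: the ONE socket σ4a is now ★ p861477; SOCKETS 1 → 0; statement bytes UNCHANGED)

Cell `hodgecm-mathlib`, crux H413 (`stmt-HodgeConjecture-24833`), programme R90-TF (HUMAN RULING «R90-TF SLAB — MAX PUSH», REQUESTS l.72925),
section S7 = Rogawski §14.6 (14.6.1)–(14.6.3) ∘ §13.3 Thm. 13.3.7 «the (N) tuple of O1″».  Typist LH7-typ2 (g0); S7-audit1 = LH7-audit1; R90-TF LEAD K2E1-plan (g7).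

PARENT NODE (junction root, C3): O1″ `F0U3LettersRung1.PKtupleBaseLetterK2μ` (leaf `Cruxes/H413/Lines/F0_P3c_PKtuplePaydown.lean` ED. 5, def :88–:217,
stub :653 `stub_PKtupleBaseK2μ`; AUDIT S7#3 CLEAN).  It is ONE connected shared-∃ block over POSITED carriers (`LocalPacketKit`, `ArchPacketKit(H)`,
`jInf dsInf`, `DiscH nH …`): FINDING F-π «POSITED-CARRIER WALL» (HEADS v1 bf9197ef8db05302) ⇒ programme LAW L8 «DEFINITIONS BEFORE SOCKETS ON
KIT-CARRIERS» (LEAD #3∕#5 (3)): no socket of this section quantifies ∀ over a posited kit, and none re-quantifies the ∃ block (C4).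

S7 PLAN OF RECORD (LEAD #3 R-a; EXPORT-EDGES-S7 v1 4733c67ae6ff0963 → v2):
* ED. 3 = THIS FILE, (α) DISCHARGE (S7 SOCKET PLAN v1 1bf103ef2afaf2c7 deal D1): the kit-free socket σ4a `stub_R90_S7_formSignOffRam` is now the TERM
  `formSignOffRam L H hH hHd μω μZ keys hquad ξ hexc v hv` (★ p861477 `Theorems/R90S7FormSignOffRam.lean`, TRIO); SOCKETS OF THIS FILE: 0; statement bytes of ED. 1∕2 kept
  token-for-token (C2: the decl name stays so every «BY NAME» pointer — row (k), file B `signProduct_of_formSignOffRam` — resolves); the plan bullets below are renumbered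
  in meaning only: «ED. 2 G-SIDE CUT» is the NEXT edition of this file, «ED. 3 H∞ CUT» the one after.
* ED. 1∕2 — the KIT-FREE layer: sockets whose statements mention no posited carrier.  Today exactly ONE, on the path of row (k)
  «sign bookkeeping» of O1″ (AUDIT S7#2 ∕ S7#5 E8 σ4a): off the exceptional set `ramOfRecord₂ ξ` the local form sign `formSignAt L c H v` is `+1`.
  It is FORCED by (k)'s shape whatever the ED. 2 definition `εOfRecord` is: (k) holds for every finite `S ⊇ ramOfRecord₂ ξ`, so `ε ξ v = 1` off
  `ramOfRecord₂ ξ`, and `ε ξ v` is `formSignAt L c H v` up to the packet sign fixed by (KT2′) (T-A `TupleKitLawsK2`, ED. 3 «K2″»).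
* ED. 2 «G-SIDE CUT» — typable the hour S4-A `R90.S4.rogawskiLocalKit` (E-S4) and S2 `R90.S2.rogawskiArchKit` ∕ `archTrGOfRecord` (E-S2, G-side) are IN
  THE TREE with PINNED packet cuts (S2 D-S2-1 resolved): the rows of O1″ that touch only DEFINED components become closed ∀-statements imported BY NAME
  (LAWS-G KG1 KG2 KG3′ KG6 KG8 KJ-G KM1–3 KT1 (+KU-G), PK-SHAPE-G, KR-1, KD1 KD2 KH1′ KJ-H — S4∕S2∕S3 theorems or their `stub_R90_S4_*`∕`stub_R90_S2_*`
  sockets), plus ONE residual ∃-socket «H∞-BLOCK» `∃ (𝔞H archTrH DiscH nH ε κH μ₂ μ₁), KU-H ∧ KH3′ ∧ KH5 ∧ KT2′ ∧ KT3 ∧ KD3 ∧ PK-SHAPE-H ∧ (k) ∧ KD4-H ∧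
  KD5-H♭ ∧ (T)` (WAITS ON G-H1 = `archTrHOfRecord`, N = 2, 1 archimedean projections), plus the PROVED composition
  `pkTupleBaseK2μ_of_sigmas : … → F0U3LettersRung1.PKtupleBaseLetterK2μ` (TRIO; `refine ⟨cOfRecord, wXi, K2E1bCarriersOfRecord.jInfOfRecord,
  K2E1bCarriersOfRecord.dsInfOfRecord, …, ⟨rogawskiLocalKit …, rogawskiArchKit, …⟩, …⟩` + rows by name).
* ED. 3 — the H∞-BLOCK cut into (T) = Thm. 14.6.1 ∘ 13.3.7, PK-SHAPE-H, (k), KD5-H♭ over the DEFINED `rogawskiArchKitH`, `discHOfRecord`, `nHOfRecord`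
  (E-S5), `εOfRecord`, `κHOfRecord` (:= the COMPOSITE scalar of ★ `F0P3SpectralPacketXiHSigned` :131, AUDIT S7#5 E8 σ4b — NOT the bare arch pairing).
WAITS ON (named, L8 (iii)): E-S4 `rogawskiLocalKit` + TOP `stub_R90_S4_localClassification` (S4 files A∕B); E-S2 `rogawskiArchKit`, `archTrGOfRecord`,
D-S2-1 (packet cut on limits of d.s. ∕ p.s. ∕ f.d.), G-H1 `archTrHOfRecord` (S2 files A∕B); E-S5 `discHOfRecord nHOfRecord infOfOfRecord aTokOfRecord`
(S5 file C); K2-defs1 canonical automorphic measures `μ₂ μ₁` (else parameters).  NO composition theorem in ED. 1 (C3 deferred per L8 (iii); this file's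
socket is consumed by ED. 2's `(k)`-row proof).

HONEST LABEL: a kit-free socket layer closes nothing.  HC_CM is proved only modulo the 7 printed citations (2 remaining named inputs: hLiu418 =
stmt-HodgeConjecture-24832, h413 = stmt-HodgeConjecture-24833) — DISTANCE TO ZERO: citations 3 ∕ leaves 7 (closable 3 · S-layer 4+) ∕ axioms 0 — until
rung 0 closes.  Sorries live ONLY in `stub_R90_S7_*`.  No `instance`, no `notation`, no `axiom`, no `opaque`.
[cite: Rogawski1990, §14.6 p. 242 «c_v = 1 for almost all v», (14.6.3) p. 243, p. 243 l. 9 – p. 244 l. 17; §13.1 p. 199; §12.2 pp. 173–174]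
-/

set_option autoImplicit false
set_option linter.dupNamespace false

noncomputable section

open NumberField IsDedekindDomain MeasureTheory
open scoped Matrix MatrixGroups

namespace Summit.HodgeConjecture.HodgeConjecture.R90.S7

open Literature.NumberTheory Literature.NumberTheory.Automorphic Literature.NumberTheory.Automorphic.UnitaryGroup
open Literature.NumberTheory.Rogawski1990 Literature.NumberTheory.GaloisRepresentations
open Summit.HodgeConjecture.HodgeConjecture.Cruxes.H413
open Summit.HodgeConjecture.HodgeConjecture.Cruxes.H413.F0P3XiLocalFamilyOfRecord
open Summit.HodgeConjecture.HodgeConjecture.Cruxes.H413.F0P3XiPacketFamilyOfRecord (ramOfRecord₂ good_of_not_mem_ramOfRecord₂)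

/-! ## §1 Socket σ4a — «off the exceptional set the local form sign is `+1`» (row (k) of O1″, kit-free) -/

/-- **σ4a `stub_R90_S7_formSignOffRam` — DISCHARGED (ED. 3) BY ★ `R90.S7.formSignOffRam` (p861477, `Theorems/R90S7FormSignOffRam.lean`, R90-C146-p01 (g0)); statement bytes = ED. 1∕2 — «`c_v = 1` off `ramOfRecord₂ ξ`», EXACT form of print's «`c_v = 1` for almost all `v`» (§14.6 p. 242)
at the record's exceptional set.**  For the hermitian matrix `H` of the frame (`IsUnit H.det`), the CM Hecke character `μω` with the frame hypothesis
`hquad` (at a non-split `v`, `μω_v` is the quadratic character of `L_w ∕ L⁺_v`), and any `ξ`, every finite place `v ∉ ramOfRecord₂ ξ` has local form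
sign `formSignAt L c H v = 1`.  WHY TRUE (prover's road, all ★ — AUDIT S7#6 A2, the DIRECT route): split `v` ⇒ `formSignAt_of_not_subsingleton`; non-split good `v` ⇒
`good_of_not_mem_ramOfRecord₂` gives `H_w ∈ GL₃(𝒪_w)` (so `−det H` is a `v`-unit) and `μω` unramified above `v`, whence ★ B1
`F0P3XiLocalFamilyOfRecordUnram.semilocalComponent_eq_one_of_forall_isUnramifiedAt` makes `μω_v` trivial on units, `hquad` unfolded
(`IsQuadraticCharExtension` = `∀ x, σ x = x → (μ x = 1 ↔ ∃ y, σ y * y = x)`, `UnitaryGroupBorelInduction` :436) makes the unit `−det H` a norm, and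
`formSignAt_def` (branch 2) gives `+1` (the Hilbert-symbol detour `formSignAt_eq_hilbertSymbol` is NOT needed).  WHY IT MIGHT FAIL: only if `good₂ ∧ hquad` does not force `v` unramified
in `L` at some non-split `v` (then a unit `−det H` may be a non-norm and the sign is `−1`) — the `hquad`-step is the content.  CONSUMER: ED. 2's proof of
row (k) of O1″ (`… ramOfRecord₂ … ξ … ⊆ S → (κH ξ : ℂ) * ∏ v : ↥S, (ε ξ v.1 : ℂ) = …`, leaf ED. 5 :195), with `S ⊇ ramOfRecord₂ ξ` arbitrary.
Binders `L H hH hHd μω μZ keys` VERBATIM from ★ `Theorems/F0P3XiPacketFamilyOfRecordUnram` :110–:119; `hquad` VERBATIM from the O1″ frame (leaf :109–:110).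
[cite: Rogawski1990, §14.6 p. 242; (14.6.3) p. 243; §3.5 Prop. 3.5.2 (c) p. 29] [cite: Omeara1963, §63B] -/
theorem stub_R90_S7_formSignOffRam
    (L : Type) [Field L] [NumberField L] [IsCMField L] (H : Matrix (Fin 3) (Fin 3) L)
    (hH : (H.map (cmConjRingHom L))ᵀ = H) (hHd : IsUnit H.det) (μω : HeckeCharacter L)
    [∀ v : HeightOneSpectrum (𝓞 ↥(maximalRealSubfield L)), MeasurableSpace (Gqs L v ⧸ Subgroup.center (Gqs L v))]
    (μZ : ∀ v : HeightOneSpectrum (𝓞 ↥(maximalRealSubfield L)), Measure (Gqs L v ⧸ Subgroup.center (Gqs L v)))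
    (keys : ∀ (ξ : OneDimAutRepH L) (v : HeightOneSpectrum (𝓞 ↥(maximalRealSubfield L))),
      (∀ w : PlacesOver L v, IsCMField.complexConj L • w.1 = w.1) →
        {p : IrrClass (Gqs L v) × IrrClass (Gqs L v) //
          KeysCaseTwoLabels L v (μω.semilocalComponent L v) (torusLocalComponent L (IsCMField.complexConj L) v ξ.η)
            (torusLocalComponent L (IsCMField.complexConj L) v ξ.ψ) p.1 p.2 ∧
          p.1.IsSquareIntegrable (μZ v) ∧ ¬ p.2.IsSquareIntegrable (μZ v)})
    (hquad : ∀ v : HeightOneSpectrum (𝓞 ↥(maximalRealSubfield L)), (∀ w : PlacesOver L v, IsCMField.complexConj L • w.1 = w.1) →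
      IsQuadraticCharExtension (conjLocal L (IsCMField.complexConj L) v) (μω.semilocalComponent L v))
    (ξ : OneDimAutRepH L)
    (hexc : ∀ᶠ v : HeightOneSpectrum (𝓞 ↥(maximalRealSubfield L)) in Filter.cofinite,
      ∀ hns : ∀ w : PlacesOver L v, IsCMField.complexConj L • w.1 = w.1,
        ((keys ξ v hns).1.2).IsSpherical (cmLocalIntegralLevel L 3 (qsForm L) v))
    (v : HeightOneSpectrum (𝓞 ↥(maximalRealSubfield L)))
    (hv : v ∉ ramOfRecord₂ L H hH hHd μω μZ keys ξ hexc) :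
    formSignAt L (IsCMField.complexConj L) H v = 1 :=
  formSignOffRam L H hH hHd μω μZ keys hquad ξ hexc v hv

/-! ## §2 Sanity (kernel-checked, sorry-free): the socket's split-place case is already ★ — shows the statement is non-vacuous and correctly oriented -/

/-- At a SPLIT place the socket's conclusion holds outright (★ `formSignAt_of_not_subsingleton`); recorded so the audit sees the socket is the
NON-SPLIT content only. [cite: Rogawski1990, §14.6 p. 242] -/
theorem formSignOffRam_split
    (L : Type) [Field L] [NumberField L] [IsCMField L] (H : Matrix (Fin 3) (Fin 3) L)
    (v : HeightOneSpectrum (𝓞 ↥(maximalRealSubfield L))) (hv : ¬ Subsingleton (PlacesOver L v)) :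
    formSignAt L (IsCMField.complexConj L) H v = 1 :=
  formSignAt_of_not_subsingleton L (IsCMField.complexConj L) H v hv

end Summit.HodgeConjecture.HodgeConjecture.R90.S7

end
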